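import Summits.PneNP.PneNP.Theorems.PhaseTwinsMacroscopicTwinsAboveConnectorConfig
import Summits.PneNP.PneNP.Theorems.PhaseTwinsPolyDepthTwinsAboveConnectorFibres

/-!
# Route PhaseTwins, crux `MacroscopicTwinsAbove` (stmt-PneNP-2720), line `literal-gadgets-cfi-apparatus`:
# the port-pattern decomposition of `Z_{𝔊(E,b)}(Y)` (support for `stub_connector`, part 2)

Sly's Lemma 2.2, second display, for the literal-gadget wiring: grouping the independent sets of
`lgGraph E loc W b` with phase vector `Y` by the family `P = (σ_{V,g})_g` of PORT PATTERNS of the copies,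

  `Z_{𝔊(E,b)}(Y) = Σ_P (Π_g Z_G(λ; Y_g, σ_V = P_g)) · lgWt(P)`   (`hardcoreZOn_lgGraph_phase_eq_sum`),

where the weight `lgWt E loc W b λ P` of a pattern family is the indicator that no pair edge is doubly occupied
(`PairOK`) times the total weight of the admissible configurations of the complex part (`CxOK`: occupied ends have
vacant ports, no inner–end edge doubly occupied). The weight is nonnegative (`lgWt_nonneg`) and its complex part
FACTORISES over the `m·K` complexes into the local factors `cxWeight` of the sibling definitions file
(`sum_cxOK_eq_prod`), each complex reading the six port vacancies `x(i,a) ∈ {0,1}` of its pattern.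
Elementary finite combinatorics (pattern of the tree's `hardcoreZOn_gadgetSubst_phaseVec_eq_sum`). [folklore]
-/

noncomputable section

open scoped Classical BigOperators

namespace Summit.PneNP.PneNP.Cruxes.MacroscopicTwinsAbove.LiteralGadgetsCfiApparatus

open Finset
open Literature.Computability.Complexity (hardcoreZOn hardcoreZOn_def slyPhase portPattern mem_portPattern_fst
  mem_portPattern_snd)
open Literature.ModelTheory.FiniteModelTheory.CFIMatching (bit)
open Summit.PneNP.PneNP.Cruxes.PolyDepthTwinsAbove.ParityWiredPorts (CxVert cxRel cxGraph cxGraph_adj cxWeight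
  sum_eq_sum_fib card_eq_sum_card_fib)

-- `Summit.PneNP.PneNP.…` (summit = sub-problem name) trips the duplicate-namespace linter on every declaration.
set_option linter.dupNamespace false

variable {nv m v P κ₁ D K : ℕ}

/-! ## The weight of a family of port patterns -/

/-- No pair edge is doubly occupied: for every variable `x` and pair slot `j`, the ports `V⁺(slot j)` of `g_{x,0}` and
`g_{x,1}` are not both occupied, and likewise for `V⁻(slot j)`. -/
def PairOK (W : LWiring v P κ₁ D K) (Pt : Fin nv × ZMod 2 → Finset (Fin P) × Finset (Fin P)) : Prop :=
  ∀ (x : Fin nv) (j : Fin κ₁),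
    ¬ (W.slot (Sum.inl j) ∈ (Pt (x, 0)).1 ∧ W.slot (Sum.inl j) ∈ (Pt (x, 1)).1) ∧
      ¬ (W.slot (Sum.inl j) ∈ (Pt (x, 0)).2 ∧ W.slot (Sum.inl j) ∈ (Pt (x, 1)).2)

/-- Admissibility of a configuration `J` of the complex part relative to the port patterns: every occupied end
`(e, j, i, a)` has its port (end slot `(loc (e,i), j)` of `g_{E e i, a}`) vacant, and no inner–end edge of the complex
of charge `b e` is doubly occupied. -/
def CxOK (E : Fin m → Fin 3 → Fin nv) (loc : Fin m × Fin 3 → Fin D) (W : LWiring v P κ₁ D K) (b : Fin m → ZMod 2)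
    (Pt : Fin nv × ZMod 2 → Finset (Fin P) × Finset (Fin P)) (J : Finset (CxPart m K)) : Prop :=
  (∀ (e : Fin m) (j : Fin K) (i : Fin 3) (a : ZMod 2),
      (Sum.inl (e, j, i, a) : CxPart m K) ∈ J → W.slot (Sum.inr (loc (e, i), j)) ∉ (Pt (E e i, a)).1) ∧
    ∀ (e : Fin m) (j : Fin K) (S' : Fin 2 → ZMod 2) (i : Fin 3),
      (Sum.inr (e, j, S') : CxPart m K) ∈ J → (Sum.inl (e, j, i, bit (b e) S' i) : CxPart m K) ∉ J

/-- **The weight of a family of port patterns**: the pair indicator times the total weight of the admissible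
configurations of the complex part. -/
def lgWt (E : Fin m → Fin 3 → Fin nv) (loc : Fin m × Fin 3 → Fin D) (W : LWiring v P κ₁ D K) (b : Fin m → ZMod 2)
    (lam : ℝ) (Pt : Fin nv × ZMod 2 → Finset (Fin P) × Finset (Fin P)) : ℝ :=
  (if PairOK W Pt then 1 else 0) * ∑ J : Finset (CxPart m K), if CxOK E loc W b Pt J then lam ^ J.card else 0

/-- The weights are nonnegative for `λ ≥ 0`. -/
theorem lgWt_nonneg (E : Fin m → Fin 3 → Fin nv) (loc : Fin m × Fin 3 → Fin D) (W : LWiring v P κ₁ D K)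
    (b : Fin m → ZMod 2) {lam : ℝ} (hlam : 0 ≤ lam) (Pt : Fin nv × ZMod 2 → Finset (Fin P) × Finset (Fin P)) :
    0 ≤ lgWt E loc W b lam Pt := by
  unfold lgWt
  refine mul_nonneg (by split_ifs <;> norm_num) (Finset.sum_nonneg fun J _ => ?_)
  split_ifs
  · exact pow_nonneg hlam _
  · exact le_rfl

/-! ## The decomposition -/

/-- Independence and phase of the configuration built from `(S, J)`, through the port patterns of the fibres. -/
theorem cond_cfgEquiv_symm_iff (E : Fin m → Fin 3 → Fin nv) (loc : Fin m × Fin 3 → Fin D) (W : LWiring v P κ₁ D K)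
    (b : Fin m → ZMod 2) (Y : Fin nv × ZMod 2 → Bool) (S : Fin nv × ZMod 2 → Finset (Fin v))
    (J : Finset (CxPart m K)) :
    ((lgGraph E loc W b).IsIndepSet (↑((cfgEquiv nv m v K).symm (S, J)) : Set (LGVert nv m v K)) ∧
        lgPhase W ((cfgEquiv nv m v K).symm (S, J)) = Y) ↔
      (∀ g, W.G.IsIndepSet (↑(S g) : Set (Fin v)) ∧ slyPhase W.Wp W.Wm (S g) = Y g) ∧
        PairOK W (fun g => portPattern W.Vp W.Vm (S g)) ∧
        CxOK E loc W b (fun g => portPattern W.Vp W.Vm (S g)) J := by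
  rw [isIndepSet_lgGraph_iff, lgPhase_cfgEquiv_symm, funext_iff]
  simp only [lgFib_cfgEquiv_symm, inl_mem_cfgEquiv_symm, inr_mem_cfgEquiv_symm, PairOK, CxOK,
    mem_portPattern_fst, mem_portPattern_snd]
  constructor
  · rintro ⟨⟨h1, h2, h3, h4⟩, h5⟩
    exact ⟨fun g => ⟨h1 g, h5 g⟩, h2, h3, h4⟩
  · rintro ⟨h1, h2, h3, h4⟩
    exact ⟨⟨fun g => (h1 g).1, h2, h3, h4⟩, fun g => (h1 g).2⟩

/-- **`Z_{𝔊(E,b)}(λ; 𝒴 = Y)` decomposed along the port patterns of the copies.** -/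
theorem hardcoreZOn_lgGraph_phase_eq_sum (E : Fin m → Fin 3 → Fin nv) (loc : Fin m × Fin 3 → Fin D)
    (W : LWiring v P κ₁ D K) (b : Fin m → ZMod 2) (lam : ℝ) (Y : Fin nv × ZMod 2 → Bool) :
    hardcoreZOn (lgGraph E loc W b) lam (fun I => lgPhase W I = Y) =
      ∑ Pt : Fin nv × ZMod 2 → Finset (Fin P) × Finset (Fin P),
        (∏ g, hardcoreZOn W.G lam (fun S => slyPhase W.Wp W.Wm S = Y g ∧ portPattern W.Vp W.Vm S = Pt g)) *
          lgWt E loc W b lam Pt := by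
  rw [hardcoreZOn_def, sum_cfgEquiv]
  simp only [hardcoreZOn_def]
  simp_rw [Fintype.prod_sum, Finset.sum_mul]
  symm
  rw [Finset.sum_comm]
  refine Finset.sum_congr rfl fun S _ => ?_
  rw [Finset.sum_eq_single (fun g => portPattern W.Vp W.Vm (S g))]
  · -- the main term: the family of port patterns of `S` itself
    by_cases hA : ∀ g, W.G.IsIndepSet (↑(S g) : Set (Fin v)) ∧ slyPhase W.Wp W.Wm (S g) = Y g
    · calc (∏ g, _) * lgWt E loc W b lam (fun g => portPattern W.Vp W.Vm (S g))
          = (∏ g : Fin nv × ZMod 2, lam ^ (S g).card) * lgWt E loc W b lam (fun g => portPattern W.Vp W.Vm (S g)) := by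
            congr 1
            exact Finset.prod_congr rfl fun g _ => if_pos ⟨(hA g).1, (hA g).2, rfl⟩
        _ = _ := ?_
      rw [prod_pow_eq_pow_sum]
      unfold lgWt
      by_cases hP : PairOK W (fun g => portPattern W.Vp W.Vm (S g))
      · rw [if_pos hP, one_mul, Finset.mul_sum]
        refine Finset.sum_congr rfl fun J _ => ?_
        by_cases hC : CxOK E loc W b (fun g => portPattern W.Vp W.Vm (S g)) J
        · rw [if_pos hC, ← pow_add, ← card_cfgEquiv_symm]
          exact (if_pos ((cond_cfgEquiv_symm_iff E loc W b Y S J).2 ⟨hA, hP, hC⟩)).symm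
        · rw [if_neg hC, mul_zero]
          exact (if_neg fun h => hC ((cond_cfgEquiv_symm_iff E loc W b Y S J).1 h).2.2).symm
      · rw [if_neg hP, zero_mul, mul_zero]
        symm
        exact Finset.sum_eq_zero fun J _ => if_neg fun h => hP ((cond_cfgEquiv_symm_iff E loc W b Y S J).1 h).2.1
    · -- some copy fails: both sides vanish
      obtain ⟨g, hg⟩ := not_forall.1 hA
      trans (0 : ℝ)
      · apply mul_eq_zero_of_left
        exact Finset.prod_eq_zero (Finset.mem_univ g) (if_neg fun h => hg ⟨h.1, h.2.1⟩)
      · symm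
        exact Finset.sum_eq_zero fun J _ => if_neg fun h => hA ((cond_cfgEquiv_symm_iff E loc W b Y S J).1 h).1
  · -- other families do not occur
    intro Pt _ hPt
    obtain ⟨g, hg⟩ : ∃ g, Pt g ≠ portPattern W.Vp W.Vm (S g) :=
      not_forall.1 fun h => hPt (funext fun g => (not_not.1 (not_not.2 (h g))))
    apply mul_eq_zero_of_left
    exact Finset.prod_eq_zero (Finset.mem_univ g) (if_neg fun h => hg h.2.2.symm)
  · exact fun h => (h (Finset.mem_univ _)).elim

/-! ## Factorisation of the complex part over the complexes -/

/-- The complex part of the vertex type as (complex index) × (abstract complex vertex). -/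
def cxSplit (m K : ℕ) : CxPart m K ≃ (Fin m × Fin K) × CxVert where
  toFun z := match z with
    | .inl (e, j, i, a) => ((e, j), Sum.inl (i, a))
    | .inr (e, j, S') => ((e, j), Sum.inr S')
  invFun w := match w with
    | ((e, j), Sum.inl (i, a)) => Sum.inl (e, j, i, a)
    | ((e, j), Sum.inr S') => Sum.inr (e, j, S')
  left_inv z := by rcases z with ⟨e, j, i, a⟩ | ⟨e, j, S'⟩ <;> rfl
  right_inv w := by rcases w with ⟨⟨e, j⟩, ⟨i, a⟩ | S'⟩ <;> rfl

/-- Independence in the abstract complex: no inner–end edge doubly occupied. -/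
theorem isIndepSet_cxGraph_iff (c : ZMod 2) (s : Finset CxVert) :
    (cxGraph c).IsIndepSet (↑s : Set CxVert) ↔
      ∀ (S' : Fin 2 → ZMod 2) (i : Fin 3), (Sum.inr S' : CxVert) ∈ s → (Sum.inl (i, bit c S' i) : CxVert) ∉ s := by
  unfold cxGraph
  rw [isIndepSet_fromRel_iff]
  constructor
  · intro h S' i hS hE
    exact h _ hS _ hE (by simp) rfl
  · intro h a ha a' ha' _ hr
    rcases a with ⟨i, x⟩ | S' <;> rcases a' with ⟨i', x'⟩ | S'' <;> simp only [cxRel] at hr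
    subst hr
    exact h S' i' ha ha'

/-- **The complex part factorises over the complexes.** With the `{0,1}`-valued port vacancies
`x_{e,j}(i,a) = [slot (loc (e,i), j) ∉ (P_{(E e i, a)})⁺]`, the total weight of the admissible configurations of the
complex part is `Π_{(e,j)} F_{b e}(λ; x_{e,j})` (`cxWeight` of the sibling definitions file). -/
theorem sum_cxOK_eq_prod (E : Fin m → Fin 3 → Fin nv) (loc : Fin m × Fin 3 → Fin D) (W : LWiring v P κ₁ D K)
    (b : Fin m → ZMod 2) (lam : ℝ) (Pt : Fin nv × ZMod 2 → Finset (Fin P) × Finset (Fin P)) :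
    ∑ J : Finset (CxPart m K), (if CxOK E loc W b Pt J then lam ^ J.card else 0) =
      ∏ c : Fin m × Fin K, cxWeight (b c.1) lam
        (fun q => if W.slot (Sum.inr (loc (c.1, q.1), c.2)) ∉ (Pt (E c.1 q.1, q.2)).1 then 1 else 0) := by
  -- pass to configurations of `(Fin m × Fin K) × CxVert`, then to families of fibres
  have step1 : ∑ J : Finset (CxPart m K), (if CxOK E loc W b Pt J then lam ^ J.card else 0) =
      ∑ t : Finset ((Fin m × Fin K) × CxVert),
        (if CxOK E loc W b Pt (t.map (cxSplit m K).symm.toEmbedding) then lam ^ t.card else 0) := by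
    refine Fintype.sum_equiv (Equiv.finsetCongr (cxSplit m K)) _ _ fun J => ?_
    have hmap : (Equiv.finsetCongr (cxSplit m K) J).map (cxSplit m K).symm.toEmbedding = J := by
      rw [Equiv.finsetCongr_apply, Finset.map_map]
      have : (cxSplit m K).toEmbedding.trans (cxSplit m K).symm.toEmbedding = Function.Embedding.refl _ := by
        ext z; simp
      rw [this, Finset.map_refl]
    rw [hmap, Equiv.finsetCongr_apply, Finset.card_map]
  rw [step1]
  -- the local weight of one complex and the weight of a family of complex configurations
  let φ : (Fin m × Fin K) → Finset CxVert → ℝ := fun c s =>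
    if ((∀ p : Fin 3 × ZMod 2, (Sum.inl p : CxVert) ∈ s → W.slot (Sum.inr (loc (c.1, p.1), c.2)) ∉ (Pt (E c.1 p.1, p.2)).1) ∧
        ∀ (S' : Fin 2 → ZMod 2) (i : Fin 3), (Sum.inr S' : CxVert) ∈ s → (Sum.inl (i, bit (b c.1) S' i) : CxVert) ∉ s)
      then lam ^ s.card else 0
  let Φ : (Fin m × Fin K → Finset CxVert) → ℝ := fun F => ∏ c, φ c (F c)
  -- membership in the transported configuration
  have hmem : ∀ (t : Finset ((Fin m × Fin K) × CxVert)) (z : CxPart m K),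
      z ∈ t.map (cxSplit m K).symm.toEmbedding ↔ (cxSplit m K z) ∈ t := fun t z => by
    rw [Finset.mem_map_equiv, Equiv.symm_symm]
  -- the summand as a function of the fibres
  have step2 : ∀ t : Finset ((Fin m × Fin K) × CxVert),
      (if CxOK E loc W b Pt (t.map (cxSplit m K).symm.toEmbedding) then lam ^ t.card else 0) =
        Φ (fun c => univ.filter fun l => (c, l) ∈ t) := by
    intro t
    have hiff : CxOK E loc W b Pt (t.map (cxSplit m K).symm.toEmbedding) ↔
        ∀ c : Fin m × Fin K, (∀ p : Fin 3 × ZMod 2, (Sum.inl p : CxVert) ∈ (univ.filter fun l => (c, l) ∈ t) →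
              W.slot (Sum.inr (loc (c.1, p.1), c.2)) ∉ (Pt (E c.1 p.1, p.2)).1) ∧
            ∀ (S' : Fin 2 → ZMod 2) (i : Fin 3), (Sum.inr S' : CxVert) ∈ (univ.filter fun l => (c, l) ∈ t) →
              (Sum.inl (i, bit (b c.1) S' i) : CxVert) ∉ (univ.filter fun l => (c, l) ∈ t) := by
      simp only [CxOK, hmem, mem_filter, mem_univ, true_and]
      constructor
      · rintro ⟨h1, h2⟩ ⟨e, j⟩
        exact ⟨fun p hp => h1 e j p.1 p.2 hp, fun S' i hS => h2 e j S' i hS⟩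
      · intro h
        exact ⟨fun e j i a hp => (h (e, j)).1 (i, a) hp, fun e j S' i hS => (h (e, j)).2 S' i hS⟩
    by_cases hC : CxOK E loc W b Pt (t.map (cxSplit m K).symm.toEmbedding)
    · rw [if_pos hC, card_eq_sum_card_fib t, ← prod_pow_eq_pow_sum]
      exact Finset.prod_congr rfl fun c _ => (if_pos ((hiff.1 hC) c)).symm
    · rw [if_neg hC]
      obtain ⟨c, hc⟩ := not_forall.1 fun h => hC (hiff.2 h)
      exact (Finset.prod_eq_zero (Finset.mem_univ c) (if_neg hc)).symm
  simp_rw [step2]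
  symm
  -- one complex: the local factor is the sum of the local weights
  have hloc : ∀ c : Fin m × Fin K,
      cxWeight (b c.1) lam (fun q => if W.slot (Sum.inr (loc (c.1, q.1), c.2)) ∉ (Pt (E c.1 q.1, q.2)).1 then 1 else 0) =
        ∑ s : Finset CxVert, φ c s := by
    intro c
    unfold cxWeight
    refine Finset.sum_congr rfl fun s _ => ?_
    by_cases hI : (cxGraph (b c.1)).IsIndepSet (↑s : Set CxVert)
    · rw [if_pos hI]
      have hI' := (isIndepSet_cxGraph_iff (b c.1) s).1 hI
      by_cases hv : ∀ p : Fin 3 × ZMod 2, (Sum.inl p : CxVert) ∈ s →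
          W.slot (Sum.inr (loc (c.1, p.1), c.2)) ∉ (Pt (E c.1 p.1, p.2)).1
      · have h1 : ∀ p ∈ (Finset.univ : Finset (Fin 3 × ZMod 2)),
            (if (Sum.inl p : CxVert) ∈ s then
                (fun q : Fin 3 × ZMod 2 =>
                  if W.slot (Sum.inr (loc (c.1, q.1), c.2)) ∉ (Pt (E c.1 q.1, q.2)).1 then (1 : ℝ) else 0) p
              else 1) = 1 := fun p _ => by
          by_cases hp : (Sum.inl p : CxVert) ∈ s
          · rw [if_pos hp]
            exact if_pos (hv p hp)
          · rw [if_neg hp]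
        rw [Finset.prod_eq_one h1, mul_one]
        exact (if_pos ⟨hv, hI'⟩).symm
      · obtain ⟨p, hp⟩ := not_forall.1 hv
        have hp' : (Sum.inl p : CxVert) ∈ s ∧ ¬ (W.slot (Sum.inr (loc (c.1, p.1), c.2)) ∉ (Pt (E c.1 p.1, p.2)).1) := by
          by_contra h'
          exact hp fun hmem => by_contra fun hvac => h' ⟨hmem, hvac⟩
        have h0 : (∏ q : Fin 3 × ZMod 2, (if (Sum.inl q : CxVert) ∈ s then
            (fun q : Fin 3 × ZMod 2 =>
              if W.slot (Sum.inr (loc (c.1, q.1), c.2)) ∉ (Pt (E c.1 q.1, q.2)).1 then (1 : ℝ) else 0) q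
            else 1)) = 0 := by
          refine Finset.prod_eq_zero (Finset.mem_univ p) ?_
          rw [if_pos hp'.1]
          exact if_neg hp'.2
        rw [h0, mul_zero]
        exact (if_neg fun h => hv h.1).symm
    · rw [if_neg hI]
      exact (if_neg fun h => hI ((isIndepSet_cxGraph_iff (b c.1) s).2 h.2)).symm
  simp_rw [hloc]
  rw [Fintype.prod_sum]
  exact (sum_eq_sum_fib Φ).symm

end Summit.PneNP.PneNP.Cruxes.MacroscopicTwinsAbove.LiteralGadgetsCfiApparatus
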